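import Summits.Ventures.PercRepro.LemmaCKernel

/-!
# The abstract Lemma C on small cubes, in the kernel

The abstract form of Lemma C (p5, `proofs/P5-C007-lemmaC.md` §4): for a finite set `W` of varying
edges, a split `S ⊆ W` into singles (`S`) and doubles (`W ∖ S`), and a **monotone cell map**
`c : Finset W → Fin 5` (cells in the row order `0 = abc`, `1 = ab|c`, `2 = ac|b`, `3 = bc|a`,
`4 = a|b|c`, ordered as the partition lattice `Π₃`: `4 ≤ 1, 2, 3 ≤ 0`), the C-007 kernel summed
over the `3^|W|` colourings `φ : W → Fin 3` — copy `i` gets the singles of colour `i` and the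
doubles of the other colours — is nonnegative (`LemmaCCube W`; p5's `LemmaCAbstract` is the Gladkov-setting form on configurations, this is the monotone-map-on-a-cube form).

Here `LemmaCCube (Fin n)` is settled by `decide +kernel` for `n ≤ 2` (`n = 2`: `5^4 = 625`
cell maps × `4` splits × `9` colourings): `lemmaCCube_fin0/1/2`.  Every class `(u, m, v)`
of a marked graph with `|u ∖ v| ≤ 2` is an instance (the graph bridge is separate).
-/

namespace PercRepro

/-- The partition order `Π₃` on the five cells: `4 = a|b|c` at the bottom, `0 = abc` at the top,
the three pair partitions in between and pairwise incomparable. -/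
def cellLE (s t : Fin 5) : Prop := s = t ∨ s = 4 ∨ t = 0

/-- The cell order is decidable. -/
instance : DecidableRel cellLE := fun s t => by unfold cellLE; infer_instance

/-- A cell map is monotone when a larger edge set gets a coarser cell. -/
def CellMono {W : Type*} [DecidableEq W] (c : Finset W → Fin 5) : Prop :=
  ∀ X Y : Finset W, X ⊆ Y → cellLE (c X) (c Y)

/-- Copy `i` of the colouring `φ`: the singles (`∈ S`) of colour `i` and the doubles (`∉ S`) of the
other colours. -/
def abstractCopy {W : Type*} [Fintype W] [DecidableEq W] (S : Finset W) (φ : W → Fin 3)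
    (i : Fin 3) : Finset W :=
  Finset.univ.filter fun e => if e ∈ S then φ e = i else φ e ≠ i

/-- The abstract class statistic `Z₃`: the C-007 kernel of the three copies' cells, summed over
all colourings. -/
def abstractZ3 {W : Type*} [Fintype W] [DecidableEq W] (c : Finset W → Fin 5) (S : Finset W) :
    ℤ :=
  ∑ φ : W → Fin 3,
    c007KernelZ (c (abstractCopy S φ 0)) (c (abstractCopy S φ 1)) (c (abstractCopy S φ 2))

/-- **The abstract Lemma C** on the cube `2^W`: every monotone cell map and every split have
`Z₃ ≥ 0`. -/
def LemmaCCube (W : Type*) [Fintype W] [DecidableEq W] : Prop :=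
  ∀ c : Finset W → Fin 5, CellMono c → ∀ S : Finset W, 0 ≤ abstractZ3 c S

/-- Monotonicity of a cell map is decidable on finite data. -/
instance {W : Type*} [Fintype W] [DecidableEq W] (c : Finset W → Fin 5) : Decidable (CellMono c) := by
  unfold CellMono; infer_instance

/-- The abstract Lemma C is decidable on a finite cube. -/
instance {W : Type*} [Fintype W] [DecidableEq W] : Decidable (LemmaCCube W) := by
  unfold LemmaCCube; infer_instance

/-- The abstract Lemma C on the empty cube. -/
theorem lemmaCCube_fin0 : LemmaCCube (Fin 0) := by decide +kernel

/-- The abstract Lemma C on the one-edge cube. -/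
theorem lemmaCCube_fin1 : LemmaCCube (Fin 1) := by decide +kernel

/-- The abstract Lemma C on the two-edge cube: `625` cell maps × `4` splits × `9` colourings. -/
theorem lemmaCCube_fin2 : LemmaCCube (Fin 2) := by decide +kernel

end PercRepro
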